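import Literature.NumberTheory.EllipticCurves.CanonicalPAdicHeightParallelogramProofs
import Literature.NumberTheory.EllipticCurves.PAdicLFunction

/-!
# BirchSwinnertonDyer / PAdicOrderV2 — crux `PAdicOrderThesisR2` (stmt-0487), line `wieferich-jet`,
# stub `stub_jetAssembly`: point shape + sigma jet ⇒ the JET CONGRUENCE of the canonical `p`-adic height

Registered stub of the lead skeleton `Cruxes/PAdicOrderThesisR2/Lines/wieferich_jet.lean`.

For `E/ℚ` (globally minimal `W`), a good ordinary prime `p ≥ 5` and an ADMISSIBLE rational point
`Q = (x, y)` (`‖x‖_p > 1`, sigma disc, non-singular reduction everywhere; Mazur–Stein–Tate 2006 §1), the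
tree's canonical cyclotomic `p`-adic height in the Stein–Wuthrich normalisation is
`ĥ_p(Q) = log_p(den x) − 2 log_p σ_p(t)`, `t = −x/y` (`WeierstrassCurve.canonicalPAdicHeight`). This file
proves, from the two registered inputs

* POINT SHAPE (Silverman AEC VII.2.2): `y ≠ 0`, `‖x‖·‖t‖² = 1`, `‖x t² − 1 + a₁ t‖ ≤ ‖t‖²`;
* SIGMA JET (Mazur–Tate: `σ_p = t + (a₁/2)t² + O(t³)` with `ℤ_p`-coefficients):
  `‖σ_p(t) − t − (a₁/2)t²‖ ≤ ‖t‖³` on the open unit disc,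

the **jet congruence** `‖ĥ_p(Q) − log_p(num x)‖ ≤ p^{−v_p(den x)}`.

Proof. With `X = x`, `s = σ_p(t)`: `log_p(num x) = log_p(X · den x) = log_p X + log_p(den x)`
(`padicLog_mul_holds`, the Iwasawa logarithm is a homomorphism on `ℚ_pˣ`), so
`ĥ_p(Q) − log_p(num x) = −log_p(X s²)`. The two inputs give `X s² ∈ 1 + t²·(‖·‖ ≤ 1)` by a ring identity
(`X s² − 1 = −¾a₁²t² − ¼a₁³t³ + e·(1 + a₁t + ¼a₁²t²) + X(2tr + a₁t²r + r²)` with `e = Xt² − 1 + a₁t`,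
`r = s − t − ½a₁t²`) and the ultrametric inequality (`p ≠ 2`, `a₁ ∈ ℤ`). The isometry of the logarithm
near `1` (`norm_padicLogSeries_eq`, `‖2‖_p = 1`) gives `‖log_p(X s²)‖ = ‖X s² − 1‖ ≤ ‖t‖² = ‖X‖⁻¹ =
p^{−v_p(den x)}` (`p ∤ num x` as `‖x‖_p > 1`).
-/

-- single-conjunct summit: `Summit.BirchSwinnertonDyer.BirchSwinnertonDyer.…` repeats the name by design
set_option linter.dupNamespace false

namespace Summit.BirchSwinnertonDyer.BirchSwinnertonDyer.Cruxes.PAdicOrderThesisR2.WieferichJet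

open Literature.NumberTheory.EllipticCurves

variable {p : ℕ} [Fact p.Prime]

/-- Ultrametric bookkeeping: a sum of two elements of the closed ball of radius `R` lies in it.
[folklore] -/
theorem norm_add_le_of_le {a b : ℚ_[p]} {R : ℝ} (ha : ‖a‖ ≤ R) (hb : ‖b‖ ≤ R) : ‖a + b‖ ≤ R :=
  (IsUltrametricDist.norm_add_le_max a b).trans (max_le ha hb)

/-- Ultrametric bookkeeping: a difference of two elements of the closed ball of radius `R` lies in
it. [folklore] -/
theorem norm_sub_le_of_le {a b : ℚ_[p]} {R : ℝ} (ha : ‖a‖ ≤ R) (hb : ‖b‖ ≤ R) : ‖a - b‖ ≤ R := by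
  rw [sub_eq_add_neg]
  exact norm_add_le_of_le ha (by rwa [norm_neg])

/-- `‖2‖_p = 1` for `p` odd. [folklore] -/
theorem norm_two_eq_one (hp : p ≠ 2) : ‖(2 : ℚ_[p])‖ = 1 := by
  have h : ‖((2 : ℕ) : ℚ_[p])‖ = 1 := by
    rw [Padic.norm_natCast_eq_one_iff]
    exact (Nat.coprime_primes (Fact.out : p.Prime) Nat.prime_two).mpr hp
  simpa using h

/-- `‖4⁻¹‖_p = 1` for `p` odd. [folklore] -/
theorem norm_inv_four_eq_one (hp : p ≠ 2) : ‖(4 : ℚ_[p])⁻¹‖ = 1 := by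
  rw [norm_inv, show (4 : ℚ_[p]) = 2 * 2 by norm_num, norm_mul, norm_two_eq_one hp]
  norm_num

/-- **The logarithm is an isometry on `1 + pℤ_p` (`p` odd):** `‖1 − y‖ < 1 ⇒ ‖log_p y‖ = ‖1 − y‖`
(`padicLog_eq_padicLogSeries` + `norm_padicLogSeries_eq`, with `‖2‖_p = 1`).
[Iwasawa 1972, §4.4] [folklore] -/
theorem norm_padicLog_eq_of_norm_one_sub_lt (hp : p ≠ 2) {y : ℚ_[p]} (hy : ‖1 - y‖ < 1) :
    ‖padicLog p y‖ = ‖1 - y‖ := by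
  rw [padicLog_eq_padicLogSeries hy]
  exact norm_padicLogSeries_eq (by rwa [norm_two_eq_one hp])

/-- **The unit computation behind the jet congruence.** In `ℚ_p`, `p` odd: if `‖X‖·‖t‖² = 1`,
`‖X t² − 1 + a t‖ ≤ ‖t‖²`, `‖s − t − (a/2) t²‖ ≤ ‖t‖³`, `‖a‖ ≤ 1` and `‖t‖ < 1`, then
`‖X s² − 1‖ ≤ ‖t‖²` — i.e. `x σ_p(t)² ≡ 1 (mod t²)` for `x t² ≡ 1 − a₁t`, `σ_p ≡ t + (a₁/2)t²`.
Ring identity + ultrametric inequality. [folklore] -/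
theorem norm_mul_sq_sub_one_le (hp : p ≠ 2) {X t s a : ℚ_[p]} (hXt : ‖X‖ * ‖t‖ ^ 2 = 1)
    (he : ‖X * t ^ 2 - 1 + a * t‖ ≤ ‖t‖ ^ 2) (hr : ‖s - t - a / 2 * t ^ 2‖ ≤ ‖t‖ ^ 3)
    (ha : ‖a‖ ≤ 1) (ht : ‖t‖ < 1) : ‖X * s ^ 2 - 1‖ ≤ ‖t‖ ^ 2 := by
  set e := X * t ^ 2 - 1 + a * t with he_def
  set r := s - t - a / 2 * t ^ 2 with hr_def
  have hid : X * s ^ 2 - 1 =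
      (e * (1 + a * t + 4⁻¹ * a ^ 2 * t ^ 2) - (3 * 4⁻¹ * a ^ 2 * t ^ 2 + 4⁻¹ * a ^ 3 * t ^ 3)) +
        X * (2 * t * r + a * t ^ 2 * r + r ^ 2) := by
    rw [he_def, hr_def]
    ring
  have ht0 : 0 ≤ ‖t‖ := norm_nonneg t
  have ht2 : ‖t‖ ^ 3 ≤ ‖t‖ ^ 2 := pow_le_pow_of_le_one ht0 ht.le (by norm_num)
  have h4 : ‖(4 : ℚ_[p])⁻¹‖ = 1 := norm_inv_four_eq_one hp
  have hat : ‖a * t‖ ≤ 1 := by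
    rw [norm_mul]; exact mul_le_one₀ ha ht0 ht.le
  -- `‖e · (1 + a t + a²t²/4)‖ ≤ ‖t‖²`
  have h1 : ‖e * (1 + a * t + 4⁻¹ * a ^ 2 * t ^ 2)‖ ≤ ‖t‖ ^ 2 := by
    rw [norm_mul]
    refine (mul_le_mul_of_nonneg_left (b := ‖1 + a * t + 4⁻¹ * a ^ 2 * t ^ 2‖) (c := 1) ?_
      (norm_nonneg e)).trans (by rw [mul_one]; exact he)
    refine norm_add_le_of_le (norm_add_le_of_le (by rw [norm_one]) hat) ?_
    rw [show (4 : ℚ_[p])⁻¹ * a ^ 2 * t ^ 2 = 4⁻¹ * (a * t) ^ 2 by ring, norm_mul, h4, one_mul,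
      norm_pow]
    exact pow_le_one₀ (norm_nonneg _) hat
  -- `‖¾a²t² + ¼a³t³‖ ≤ ‖t‖²`
  have h2 : ‖3 * 4⁻¹ * a ^ 2 * t ^ 2 + 4⁻¹ * a ^ 3 * t ^ 3‖ ≤ ‖t‖ ^ 2 := by
    have h3 : ‖(3 : ℚ_[p])‖ ≤ 1 := by simpa using Padic.norm_int_le_one (p := p) 3
    have ha2 : ‖a‖ ^ 2 ≤ 1 := pow_le_one₀ (norm_nonneg a) ha
    have ha3 : ‖a‖ ^ 3 ≤ 1 := pow_le_one₀ (norm_nonneg a) ha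
    refine norm_add_le_of_le ?_ ?_
    · rw [norm_mul, norm_mul, norm_mul, h4, norm_pow, norm_pow, mul_one]
      calc ‖(3 : ℚ_[p])‖ * ‖a‖ ^ 2 * ‖t‖ ^ 2 ≤ 1 * 1 * ‖t‖ ^ 2 := by gcongr
        _ = ‖t‖ ^ 2 := by ring
    · rw [norm_mul, norm_mul, h4, one_mul, norm_pow, norm_pow]
      calc ‖a‖ ^ 3 * ‖t‖ ^ 3 ≤ 1 * ‖t‖ ^ 2 := by gcongr
        _ = ‖t‖ ^ 2 := one_mul _
  -- `‖X (2tr + at²r + r²)‖ ≤ ‖t‖²`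
  have h3 : ‖X * (2 * t * r + a * t ^ 2 * r + r ^ 2)‖ ≤ ‖t‖ ^ 2 := by
    have hX : ‖X‖ * ‖t‖ ^ 2 = 1 := hXt
    have h2le : ‖(2 : ℚ_[p])‖ ≤ 1 := by simpa using Padic.norm_int_le_one (p := p) 2
    have hr' : ‖r‖ ≤ ‖t‖ ^ 3 := hr
    -- each summand of `X·(…)` is bounded by `‖t‖²` after multiplying by `‖X‖ = ‖t‖⁻²`
    have k1 : ‖X * (2 * t * r)‖ ≤ ‖t‖ ^ 2 := by
      rw [norm_mul, norm_mul, norm_mul]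
      calc ‖X‖ * (‖(2 : ℚ_[p])‖ * ‖t‖ * ‖r‖) ≤ ‖X‖ * (1 * ‖t‖ * ‖t‖ ^ 3) := by gcongr
        _ = ‖X‖ * ‖t‖ ^ 2 * ‖t‖ ^ 2 := by ring
        _ = ‖t‖ ^ 2 := by rw [hX, one_mul]
    have k2 : ‖X * (a * t ^ 2 * r)‖ ≤ ‖t‖ ^ 2 := by
      rw [norm_mul, norm_mul, norm_mul, norm_pow]
      calc ‖X‖ * (‖a‖ * ‖t‖ ^ 2 * ‖r‖) ≤ ‖X‖ * (1 * ‖t‖ ^ 2 * ‖t‖ ^ 3) := by gcongr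
        _ = ‖X‖ * ‖t‖ ^ 2 * ‖t‖ ^ 3 := by ring
        _ = ‖t‖ ^ 3 := by rw [hX, one_mul]
        _ ≤ ‖t‖ ^ 2 := ht2
    have k3 : ‖X * r ^ 2‖ ≤ ‖t‖ ^ 2 := by
      rw [norm_mul, norm_pow]
      have ht4 : ‖t‖ ^ 4 ≤ ‖t‖ ^ 2 := pow_le_pow_of_le_one ht0 ht.le (by norm_num)
      calc ‖X‖ * ‖r‖ ^ 2 ≤ ‖X‖ * (‖t‖ ^ 3) ^ 2 := by gcongr
        _ = ‖X‖ * ‖t‖ ^ 2 * ‖t‖ ^ 4 := by ring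
        _ = ‖t‖ ^ 4 := by rw [hX, one_mul]
        _ ≤ ‖t‖ ^ 2 := ht4
    rw [mul_add, mul_add]
    exact norm_add_le_of_le (norm_add_le_of_le k1 k2) k3
  rw [hid]
  exact norm_add_le_of_le (norm_sub_le_of_le h1 h2) h3

/-- **Stub `stub_jetAssembly` of line `wieferich-jet` (crux `PAdicOrderThesisR2`, stmt-0487): point
shape + sigma jet ⇒ the JET CONGRUENCE.** For `E/ℚ` (globally minimal `W`), a good ordinary prime
`p ≥ 5` and an admissible rational point `(x, y)`:
`‖ĥ_p(x, y) − log_p(num x)‖_p ≤ p^{−v_p(den x)}`, where `ĥ_p` is the tree's canonical cyclotomic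
`p`-adic height `log_p(den x) − 2 log_p σ_p(−x/y)` (Stein–Wuthrich 2013 §4.1 (4.1)) and `log_p` the
Iwasawa logarithm — GIVEN the valuation shape of the point (`‖x‖‖t‖² = 1`, `‖x t² − 1 + a₁t‖ ≤ ‖t‖²`,
`t = −x/y`) and the `t³`-jet of the Mazur–Tate sigma function (`‖σ_p(t) − t − (a₁/2)t²‖ ≤ ‖t‖³`).
Equivalently `ĥ_p(a/d², b/d³) ≡ log_p a (mod p^{v_p(d²)})`: the universal `E₂`-free truncation of
the sigma function reads the height modulo the square of the denominator.
[Mazur–Stein–Tate 2006, Thm. 1.3 and §4.1; Stein–Wuthrich 2013, §4.1 eq. (4.1)] -/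
theorem stub_jetAssembly :
    (∀ (W : WeierstrassCurve ℚ) [W.IsGloballyMinimal] (p : ℕ) [Fact p.Prime] {x y : ℚ},
      W.toAffine.Nonsingular x y → 1 < ‖(x : ℚ_[p])‖ →
        (y : ℚ_[p]) ≠ 0 ∧ ‖(x : ℚ_[p])‖ * ‖-(x : ℚ_[p]) / y‖ ^ 2 = 1 ∧
          ‖(x : ℚ_[p]) * (-(x : ℚ_[p]) / y) ^ 2 - 1 + (W.a₁ : ℚ_[p]) * (-(x : ℚ_[p]) / y)‖
            ≤ ‖-(x : ℚ_[p]) / y‖ ^ 2) →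
    (∀ (W : WeierstrassCurve ℚ) [W.IsElliptic] [W.IsGloballyMinimal] (p : ℕ) [Fact p.Prime],
      5 ≤ p → IsOrdinaryAt W p → ∀ (t : ℚ_[p]), ‖t‖ < 1 →
        ‖W.padicSigmaEval p t - t - (W.a₁ : ℚ_[p]) / 2 * t ^ 2‖ ≤ ‖t‖ ^ 3) →
    ∀ (W : WeierstrassCurve ℚ) [W.IsElliptic] [W.IsGloballyMinimal] (p : ℕ) [Fact p.Prime],
      5 ≤ p → IsOrdinaryAt W p →
      ∀ {x y : ℚ} (h : W.toAffine.Nonsingular x y), W.IsAdmissible p (.some x y h) →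
        ‖W.canonicalPAdicHeight p (.some x y h) - padicLog p ((x.num : ℚ) : ℚ_[p])‖
          ≤ (p : ℝ) ^ (-(padicValNat p x.den : ℤ)) := by
  intro hP hS W _ _ p _ h5 hord x y h hadm
  have hp2 : p ≠ 2 := by omega
  obtain ⟨hx1, -, -⟩ : 1 < ‖((x : ℚ) : ℚ_[p])‖ ∧ _ ∧ _ := hadm.2
  obtain ⟨hY0, hXt, he⟩ := hP W p h hx1
  set X : ℚ_[p] := (x : ℚ_[p]) with hX_def
  set t : ℚ_[p] := -X / (y : ℚ_[p]) with ht_def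
  -- `X ≠ 0`, `t ≠ 0`, `‖t‖ < 1`
  have hX0 : X ≠ 0 := by
    rintro h0
    rw [h0, norm_zero] at hx1
    exact not_lt.mpr zero_le_one hx1
  have ht0 : t ≠ 0 := by
    intro h0
    rw [h0, norm_zero, zero_pow two_ne_zero, mul_zero] at hXt
    exact zero_ne_one hXt
  have ht1 : ‖t‖ < 1 := by
    by_contra hle
    push Not at hle
    have h1 : 1 ≤ ‖t‖ ^ 2 := one_le_pow₀ hle
    have h2 : ‖X‖ ≤ ‖X‖ * ‖t‖ ^ 2 := le_mul_of_one_le_right (norm_nonneg X) h1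
    rw [hXt] at h2
    exact absurd hx1 (not_lt.mpr h2)
  -- the sigma value `s = σ_p(t) ≠ 0` and its jet
  set s : ℚ_[p] := W.padicSigmaEval p t with hs_def
  have hr : ‖s - t - (W.a₁ : ℚ_[p]) / 2 * t ^ 2‖ ≤ ‖t‖ ^ 3 := hS W p h5 hord t ht1
  have hs0 : s ≠ 0 := W.padicSigmaEval_ne_zero p ht0 ht1
  -- `a₁ ∈ ℤ`
  have ha : ‖(W.a₁ : ℚ_[p])‖ ≤ 1 := by
    obtain ⟨W_int, hW⟩ := (inferInstance : W.IsIntegral ℤ).integral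
    have h1 : W.a₁ = (W_int.a₁ : ℚ) := by
      rw [hW]; simp [WeierstrassCurve.baseChange, WeierstrassCurve.map_a₁]
    rw [h1, Rat.cast_intCast]
    exact Padic.norm_int_le_one _
  -- `‖X s² − 1‖ ≤ ‖t‖²`
  have hkey : ‖X * s ^ 2 - 1‖ ≤ ‖t‖ ^ 2 := norm_mul_sq_sub_one_le hp2 hXt he hr ha ht1
  -- numerator and denominator of `x` in `ℚ_p`
  set D : ℚ_[p] := ((x.den : ℚ) : ℚ_[p]) with hD_def
  set N : ℚ_[p] := ((x.num : ℚ) : ℚ_[p]) with hN_def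
  have hD_nat : D = ((x.den : ℕ) : ℚ_[p]) := by rw [hD_def, Rat.cast_natCast]
  have hN_int : N = ((x.num : ℤ) : ℚ_[p]) := by rw [hN_def, Rat.cast_intCast]
  have hD0 : D ≠ 0 := by rw [hD_nat]; exact_mod_cast x.den_nz
  have hN : N = X * D := by
    rw [hN_def, hX_def, hD_def, ← Rat.cast_mul, Rat.mul_den_eq_num]
  have hDle : ‖D‖ ≤ 1 := by rw [hD_nat]; exact_mod_cast Padic.norm_int_le_one (p := p) (x.den : ℤ)
  have hNle : ‖N‖ ≤ 1 := by rw [hN_int]; exact Padic.norm_int_le_one _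
  -- `p ∣ den x`, hence `p ∤ num x`, hence `‖N‖ = 1`
  have hDlt : ‖D‖ < 1 := by
    by_contra hle
    push Not at hle
    have hD1 : ‖D‖ = 1 := le_antisymm hDle hle
    have : ‖N‖ = ‖X‖ := by rw [hN, norm_mul, hD1, mul_one]
    exact absurd (this ▸ hNle) (not_le.mpr hx1)
  have hpden : p ∣ x.den := by rwa [hD_nat, Padic.norm_natCast_lt_one_iff] at hDlt
  have hndvd : ¬ (p : ℤ) ∣ x.num := by
    intro hnum
    have h1 : p ∣ x.num.natAbs := Int.natCast_dvd.mp hnum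
    have h2 : p ∣ Nat.gcd x.num.natAbs x.den := Nat.dvd_gcd h1 hpden
    rw [x.reduced.gcd_eq_one] at h2
    exact (Fact.out : p.Prime).one_lt.ne' (Nat.dvd_one.mp h2)
  have hN1 : ‖N‖ = 1 := by
    refine le_antisymm hNle (not_lt.mp ?_)
    rw [hN_int, Padic.norm_intCast_lt_one_iff]
    exact hndvd
  -- `‖t‖² = ‖D‖ = p^{-v_p(den x)}`
  have hXD : ‖X‖ * ‖D‖ = 1 := by rw [← norm_mul, ← hN, hN1]
  have ht2 : ‖t‖ ^ 2 = ‖D‖ :=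
    mul_left_cancel₀ (norm_ne_zero_iff.mpr hX0) (hXt.trans hXD.symm)
  have hDval : ‖D‖ = (p : ℝ) ^ (-(padicValNat p x.den : ℤ)) := by
    rw [hD_nat, Padic.norm_eq_zpow_neg_valuation (by exact_mod_cast x.den_nz),
      Padic.valuation_natCast]
  -- the logarithms
  have hh : W.canonicalPAdicHeight p (.some x y h) = padicLog p D - 2 * padicLog p s := rfl
  have hlogN : padicLog p N = padicLog p X + padicLog p D := by
    rw [hN]; exact padicLog_mul_holds p hX0 hD0
  have hlogXs : padicLog p (X * s ^ 2) = padicLog p X + 2 * padicLog p s := by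
    rw [sq, ← mul_assoc, padicLog_mul_holds p (mul_ne_zero hX0 hs0) hs0,
      padicLog_mul_holds p hX0 hs0]
    ring
  have hdiff : W.canonicalPAdicHeight p (.some x y h) - padicLog p N = -padicLog p (X * s ^ 2) := by
    rw [hh, hlogN, hlogXs]; ring
  have hone : ‖1 - X * s ^ 2‖ < 1 := by
    rw [norm_sub_rev]
    exact hkey.trans_lt (by rw [ht2]; exact hDlt)
  rw [hdiff, norm_neg, norm_padicLog_eq_of_norm_one_sub_lt hp2 hone, norm_sub_rev, ← hDval, ← ht2]
  exact hkey

end Summit.BirchSwinnertonDyer.BirchSwinnertonDyer.Cruxes.PAdicOrderThesisR2.WieferichJet
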